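import Summits.NavierStokesRegularity.NavierStokesRegularity.Theorems.RellichScarScarRigidityVorticityDefectKinematics
import HarnessLib

/-!
# `ScarRigidity`, line `moment-conditioned-rellich` — stub `stub_vorticityDefectDecay` (V-rung), part 2:
# the evolution of the antisymmetric gradient of the twin difference (the pressure drops out)

Crux stmt-NavierStokesRegularity-11717 (route RellichScar), helper file (`--supports`) for the registered stub
`stub_vorticityDefectDecay`.  For two classical Navier–Stokes pairs `(V₁, Q₁)`, `(V₂, Q₂)` (`ν = 1`, `f = 0`) on the
open backward slab, `w = V₁ − V₂` obeys `∂ₜw = G − ∇(Q₁ − Q₂)` with the DEFECT SOURCE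
`G = Δw − ((w·∇)V₁ + (V₂·∇)w)` (`deriv_twinDiff_eq`), so the antisymmetric gradient `A_ij = ∂ᵢw_j − ∂ⱼw_i`
obeys `∂ₜA_ij = A_ij[G]` (exchange of `∂ₜ` with `∂ᵢ`, Schwarz; the Hessian of the pressure difference is
symmetric: `deriv_antisymGrad_twinDiff_eq`), and likewise for all spatial derivatives
(`hasDerivAt_iteratedFDeriv_antisymGrad_twinDiff`).  With the scale-invariant packages and cubic flatness
(global form, part 1) every derivative of `G` is bounded by `C(−t)/(‖y‖+√(−t))^{5+n}` on the whole slab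
(`exists_defectSource_bound`), hence `‖∂ₜDᵏA_ij(t,y)‖ ≤ D(−t)/(‖y‖+√(−t))^{6+k}` (`exists_antisymGrad_rate_bound`).
-/

noncomputable section

open Set Filter Function MeasureTheory Metric TopologicalSpace
open scoped Topology ContDiff Laplacian InnerProductSpace RealInnerProductSpace
open Literature.Analysis.FluidPDE

set_option linter.dupNamespace false -- D-0017: `Summit.<S>.<S>.…` repeats the summit name by design

-- nested operator types
set_option maxSynthPendingDepth 4

namespace Summit.NavierStokesRegularity.NavierStokesRegularity.Theorems.RellichScarScarRigidity

open Summit.NavierStokesRegularity.NavierStokesRegularity.Theorems.SymmetricScarExists.LogtimeBernoulli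
  (timeDeriv_eq_of_classical)

/-! ### The antisymmetric gradient of a jointly smooth field: smoothness and time derivative -/

section General

variable {w : ℝ → EuclideanSpace ℝ (Fin 3) → EuclideanSpace ℝ (Fin 3)}

/-- The antisymmetric gradient `(t, y) ↦ A_ij[w(t)](y)` of a field jointly smooth on the open backward slab is
jointly smooth there. [folklore] -/
theorem isSmoothSpaceTimeOn_antisymGrad (hw : IsSmoothSpaceTimeOn (Iio (0 : ℝ)) w) (i j : Fin 3) :
    IsSmoothSpaceTimeOn (Iio (0 : ℝ)) fun t y =>
      (fderiv ℝ (w t) y (EuclideanSpace.single i (1 : ℝ))) j - (fderiv ℝ (w t) y (EuclideanSpace.single j (1 : ℝ))) i :=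
  ((hw.isSmoothSpaceTimeOn_fderiv_apply isOpen_Iio (EuclideanSpace.single i (1 : ℝ))).clm (EuclideanSpace.proj j)).sub
    ((hw.isSmoothSpaceTimeOn_fderiv_apply isOpen_Iio (EuclideanSpace.single j (1 : ℝ))).clm (EuclideanSpace.proj i))

/-- **`∂ₜA_ij[w] = A_ij[∂ₜw]`** for a field jointly smooth on the open backward slab (exchange of `∂ₜ` and
`∂ᵢ`, Schwarz). [folklore] -/
theorem hasDerivAt_antisymGrad_slice (hw : IsSmoothSpaceTimeOn (Iio (0 : ℝ)) w) {t : ℝ} (ht : t < 0)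
    (y : EuclideanSpace ℝ (Fin 3)) (i j : Fin 3) :
    HasDerivAt (fun s => (fderiv ℝ (w s) y (EuclideanSpace.single i (1 : ℝ))) j - (fderiv ℝ (w s) y (EuclideanSpace.single j (1 : ℝ))) i)
      ((fderiv ℝ (fun z => deriv (fun s => w s z) t) y (EuclideanSpace.single i (1 : ℝ))) j -
        (fderiv ℝ (fun z => deriv (fun s => w s z) t) y (EuclideanSpace.single j (1 : ℝ))) i) t := by
  have h1 := hw.hasDerivAt_fderiv_slice isOpen_Iio ht y (EuclideanSpace.single i (1 : ℝ))
  have h2 := hw.hasDerivAt_fderiv_slice isOpen_Iio ht y (EuclideanSpace.single j (1 : ℝ))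
  exact ((EuclideanSpace.proj j : EuclideanSpace ℝ (Fin 3) →L[ℝ] ℝ).hasFDerivAt.comp_hasDerivAt t h1).sub
    ((EuclideanSpace.proj i : EuclideanSpace ℝ (Fin 3) →L[ℝ] ℝ).hasFDerivAt.comp_hasDerivAt t h2)

end General

/-! ### The twin difference: `∂ₜw = G − ∇(Q₁ − Q₂)` and `∂ₜA = A[G]` -/

section Twins

variable {V₁ V₂ : ℝ → EuclideanSpace ℝ (Fin 3) → EuclideanSpace ℝ (Fin 3)} {Q₁ Q₂ : ℝ → EuclideanSpace ℝ (Fin 3) → ℝ}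

/-- Gradients of smooth functions are smooth. [folklore] -/
theorem contDiff_gradient_top {π : EuclideanSpace ℝ (Fin 3) → ℝ} (hπ : ContDiff ℝ ∞ π) : ContDiff ℝ ∞ (gradient π) :=
  (InnerProductSpace.toDual ℝ (EuclideanSpace ℝ (Fin 3))).symm.contDiff.comp (hπ.fderiv_right (m := ∞) le_rfl)

/-- **The difference of the two momentum equations**: for `t < 0`,
`∂ₜ(V₁ − V₂)(t, y) = G(t, y) − (∇Q₁(t, y) − ∇Q₂(t, y))` with the defect source
`G = Δw − ((w·∇)V₁ + (V₂·∇)w)`, `w = V₁ − V₂` (bilinearity of the convective term). [folklore] -/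
theorem deriv_twinDiff_eq (hcl₁ : IsClassicalNSSolutionOn (Iio (0 : ℝ)) 1 0 V₁ Q₁)
    (hcl₂ : IsClassicalNSSolutionOn (Iio (0 : ℝ)) 1 0 V₂ Q₂) {t : ℝ} (ht : t < 0) (y : EuclideanSpace ℝ (Fin 3)) :
    deriv (fun s => V₁ s y - V₂ s y) t =
      (Δ (fun z => V₁ t z - V₂ t z) y -
          (convect (fun z => V₁ t z - V₂ t z) (V₁ t) y + convect (V₂ t) (fun z => V₁ t z - V₂ t z) y)) -
        (gradient (Q₁ t) y - gradient (Q₂ t) y) := by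
  have h₁ := congrFun (timeDeriv_eq_of_classical hcl₁ ht) y
  have h₂ := congrFun (timeDeriv_eq_of_classical hcl₂ ht) y
  simp only [timeDeriv_apply] at h₁ h₂
  have hd₁ : DifferentiableAt ℝ (fun s => V₁ s y) t :=
    (hcl₁.smooth_velocity.hasDerivAt_timeLine isOpen_Iio ht y).differentiableAt
  have hd₂ : DifferentiableAt ℝ (fun s => V₂ s y) t :=
    (hcl₂.smooth_velocity.hasDerivAt_timeLine isOpen_Iio ht y).differentiableAt
  rw [deriv_fun_sub hd₁ hd₂, h₁, h₂]
  have hV₁ : ContDiff ℝ ∞ (V₁ t) := hcl₁.contDiff_velocity ht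
  have hV₂ : ContDiff ℝ ∞ (V₂ t) := hcl₂.contDiff_velocity ht
  have hΔ : Δ (fun z => V₁ t z - V₂ t z) y = Δ (V₁ t) y - Δ (V₂ t) y :=
    ContDiffAt.laplacian_sub (hV₁.of_le (by norm_cast)).contDiffAt
      (hV₂.of_le (by norm_cast)).contDiffAt
  have hc : convect (fun z => V₁ t z - V₂ t z) (V₁ t) y + convect (V₂ t) (fun z => V₁ t z - V₂ t z) y =
      convect (V₁ t) (V₁ t) y - convect (V₂ t) (V₂ t) y := by
    simp only [convect_apply]
    rw [fderiv_fun_sub (hV₁.differentiable (by simp) y) (hV₂.differentiable (by simp) y)]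
    simp only [_root_.sub_apply, map_sub]
    abel
  rw [hΔ, hc]
  abel

/-- The twin difference is jointly smooth on the open backward slab. [folklore] -/
theorem isSmoothSpaceTimeOn_twinDiff (hcl₁ : IsClassicalNSSolutionOn (Iio (0 : ℝ)) 1 0 V₁ Q₁)
    (hcl₂ : IsClassicalNSSolutionOn (Iio (0 : ℝ)) 1 0 V₂ Q₂) :
    IsSmoothSpaceTimeOn (Iio (0 : ℝ)) fun t y => V₁ t y - V₂ t y :=
  hcl₁.smooth_velocity.sub hcl₂.smooth_velocity

/-- The slices of the defect source are smooth. [folklore] -/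
theorem contDiff_defectSource_slice (hcl₁ : IsClassicalNSSolutionOn (Iio (0 : ℝ)) 1 0 V₁ Q₁)
    (hcl₂ : IsClassicalNSSolutionOn (Iio (0 : ℝ)) 1 0 V₂ Q₂) {t : ℝ} (ht : t < 0) :
    ContDiff ℝ ∞ fun y => Δ (fun z => V₁ t z - V₂ t z) y -
      (convect (fun z => V₁ t z - V₂ t z) (V₁ t) y + convect (V₂ t) (fun z => V₁ t z - V₂ t z) y) :=
  contDiff_defectSource ((hcl₁.contDiff_velocity ht).sub (hcl₂.contDiff_velocity ht))
    (hcl₁.contDiff_velocity ht) (hcl₂.contDiff_velocity ht)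

/-- **`∂ₜA_ij = A_ij[G]`: the pressure drops out.**  For `t < 0` and every `y`, the time derivative of
`A_ij[w(·)](y)` at `t` is `A_ij[G(t)](y)` (exchange `∂ₜ∂ᵢ = ∂ᵢ∂ₜ`, the difference of the momentum equations,
and `A_ij[∇π] = 0` for the smooth pressures). [folklore] -/
theorem deriv_antisymGrad_twinDiff_eq (hcl₁ : IsClassicalNSSolutionOn (Iio (0 : ℝ)) 1 0 V₁ Q₁)
    (hcl₂ : IsClassicalNSSolutionOn (Iio (0 : ℝ)) 1 0 V₂ Q₂) {t : ℝ} (ht : t < 0) (y : EuclideanSpace ℝ (Fin 3)) (i j : Fin 3) :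
    deriv (fun s => (fderiv ℝ (fun z => V₁ s z - V₂ s z) y (EuclideanSpace.single i (1 : ℝ))) j -
        (fderiv ℝ (fun z => V₁ s z - V₂ s z) y (EuclideanSpace.single j (1 : ℝ))) i) t =
      (fderiv ℝ (fun y => Δ (fun z => V₁ t z - V₂ t z) y -
            (convect (fun z => V₁ t z - V₂ t z) (V₁ t) y + convect (V₂ t) (fun z => V₁ t z - V₂ t z) y))
          y (EuclideanSpace.single i (1 : ℝ))) j -
        (fderiv ℝ (fun y => Δ (fun z => V₁ t z - V₂ t z) y -
            (convect (fun z => V₁ t z - V₂ t z) (V₁ t) y + convect (V₂ t) (fun z => V₁ t z - V₂ t z) y))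
          y (EuclideanSpace.single j (1 : ℝ))) i := by
  rw [(hasDerivAt_antisymGrad_slice (isSmoothSpaceTimeOn_twinDiff hcl₁ hcl₂) ht y i j).deriv]
  have e : (fun z => deriv (fun s => V₁ s z - V₂ s z) t) = fun z =>
      (Δ (fun z => V₁ t z - V₂ t z) z -
          (convect (fun z => V₁ t z - V₂ t z) (V₁ t) z + convect (V₂ t) (fun z => V₁ t z - V₂ t z) z)) -
        (gradient (Q₁ t) z - gradient (Q₂ t) z) := funext fun z => deriv_twinDiff_eq hcl₁ hcl₂ ht z
  rw [e]
  have hG := contDiff_defectSource_slice hcl₁ hcl₂ ht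
  have hQ₁ : ContDiff ℝ ∞ (Q₁ t) := hcl₁.contDiff_pressure ht
  have hQ₂ : ContDiff ℝ ∞ (Q₂ t) := hcl₂.contDiff_pressure ht
  have hg₁ : ContDiff ℝ ∞ (gradient (Q₁ t)) := contDiff_gradient_top hQ₁
  have hg₂ : ContDiff ℝ ∞ (gradient (Q₂ t)) := contDiff_gradient_top hQ₂
  rw [antisymGrad_sub_apply (hG.differentiable (by simp) y) ((hg₁.sub hg₂).differentiable (by simp) y),
    antisymGrad_sub_apply (hg₁.differentiable (by simp) y) (hg₂.differentiable (by simp) y),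
    antisymGrad_gradient_eq_zero (hQ₁.of_le (by norm_cast)) y i j,
    antisymGrad_gradient_eq_zero (hQ₂.of_le (by norm_cast)) y i j, sub_zero, sub_zero]

/-- **`∂ₜDᵏA_ij = DᵏA_ij[G]` at every order** (`hasDerivAt_iteratedFDeriv_slice` for the jointly smooth field
`A_ij`, and the pointwise identity `∂ₜA_ij = A_ij[G]`). [folklore] -/
theorem hasDerivAt_iteratedFDeriv_antisymGrad_twinDiff (hcl₁ : IsClassicalNSSolutionOn (Iio (0 : ℝ)) 1 0 V₁ Q₁)
    (hcl₂ : IsClassicalNSSolutionOn (Iio (0 : ℝ)) 1 0 V₂ Q₂) (k : ℕ) {t : ℝ} (ht : t < 0) (x : EuclideanSpace ℝ (Fin 3))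
    (i j : Fin 3) :
    HasDerivAt (fun s => iteratedFDeriv ℝ k (fun y => (fderiv ℝ (fun z => V₁ s z - V₂ s z) y (EuclideanSpace.single i (1 : ℝ))) j -
        (fderiv ℝ (fun z => V₁ s z - V₂ s z) y (EuclideanSpace.single j (1 : ℝ))) i) x)
      (iteratedFDeriv ℝ k (fun y =>
        (fderiv ℝ (fun y => Δ (fun z => V₁ t z - V₂ t z) y -
            (convect (fun z => V₁ t z - V₂ t z) (V₁ t) y + convect (V₂ t) (fun z => V₁ t z - V₂ t z) y))
          y (EuclideanSpace.single i (1 : ℝ))) j -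
        (fderiv ℝ (fun y => Δ (fun z => V₁ t z - V₂ t z) y -
            (convect (fun z => V₁ t z - V₂ t z) (V₁ t) y + convect (V₂ t) (fun z => V₁ t z - V₂ t z) y))
          y (EuclideanSpace.single j (1 : ℝ))) i) x) t := by
  have hA := isSmoothSpaceTimeOn_antisymGrad (isSmoothSpaceTimeOn_twinDiff hcl₁ hcl₂) i j
  have h := hasDerivAt_iteratedFDeriv_slice hA isOpen_Iio k t ht x
  have e : (fun y => deriv (fun s => (fderiv ℝ (fun z => V₁ s z - V₂ s z) y (EuclideanSpace.single i (1 : ℝ))) j -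
      (fderiv ℝ (fun z => V₁ s z - V₂ s z) y (EuclideanSpace.single j (1 : ℝ))) i) t) = fun y =>
        (fderiv ℝ (fun y => Δ (fun z => V₁ t z - V₂ t z) y -
            (convect (fun z => V₁ t z - V₂ t z) (V₁ t) y + convect (V₂ t) (fun z => V₁ t z - V₂ t z) y))
          y (EuclideanSpace.single i (1 : ℝ))) j -
        (fderiv ℝ (fun y => Δ (fun z => V₁ t z - V₂ t z) y -
            (convect (fun z => V₁ t z - V₂ t z) (V₁ t) y + convect (V₂ t) (fun z => V₁ t z - V₂ t z) y))
          y (EuclideanSpace.single j (1 : ℝ))) i := funext fun y => deriv_antisymGrad_twinDiff_eq hcl₁ hcl₂ ht y i j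
  rw [e] at h
  exact h

/-! ### Global bounds for the defect source and for `∂ₜDᵏA` -/

/-- **All derivatives of the defect source on the whole slab**:
`‖DⁿG(t,·)(y)‖ ≤ C(−t)/(‖y‖+√(−t))^{5+n}` (global cubic flatness of `w`, the velocity packages, and the
Leibniz bound `norm_iteratedFDeriv_defectSource_le`). [folklore] -/
theorem exists_defectSource_bound (hcl₁ : IsClassicalNSSolutionOn (Iio (0 : ℝ)) 1 0 V₁ Q₁)
    (hcl₂ : IsClassicalNSSolutionOn (Iio (0 : ℝ)) 1 0 V₂ Q₂) (hB₁ : ScaleInvariantBounds V₁ Q₁)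
    (hB₂ : ScaleInvariantBounds V₂ Q₂) (hF : FarDecay 3 V₁ V₂) (n : ℕ) :
    ∃ C : ℝ, 0 ≤ C ∧ ∀ t < 0, ∀ y : EuclideanSpace ℝ (Fin 3),
      ‖iteratedFDeriv ℝ n (fun y => Δ (fun z => V₁ t z - V₂ t z) y -
          (convect (fun z => V₁ t z - V₂ t z) (V₁ t) y + convect (V₂ t) (fun z => V₁ t z - V₂ t z) y)) y‖ ≤
        C * (-t) / (‖y‖ + Real.sqrt (-t)) ^ (5 + n) := by
  obtain ⟨W, hW0, hW⟩ :=
    exists_global_cubic_flatness hcl₁.smooth_velocity hcl₂.smooth_velocity hB₁ hB₂ hF (n + 2)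
  obtain ⟨L, hL0, hL⟩ := exists_twin_velocity_bounds hB₁ hB₂ (n + 1)
  refine ⟨(3 + 2 ^ (n + 1) * L) * W, by positivity, fun t ht y => ?_⟩
  have hσ : 0 < Real.sqrt (-t) := Real.sqrt_pos.2 (by linarith)
  have hρ : 0 < ‖y‖ + Real.sqrt (-t) := by positivity
  have hw : ContDiff ℝ ∞ (fun z => V₁ t z - V₂ t z) := (hcl₁.contDiff_velocity ht).sub (hcl₂.contDiff_velocity ht)
  have h := norm_iteratedFDeriv_defectSource_le hw (hcl₁.contDiff_velocity ht) (hcl₂.contDiff_velocity ht)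
    (n := n) (p := 3) hρ (mul_nonneg hW0 (by linarith)) hL0 (fun b hb => hW b hb t ht y)
    (fun b hb => (hL b hb t ht y).1) (fun b hb => (hL b hb t ht y).2)
  rw [show 3 + 2 + n = 5 + n by ring] at h
  refine h.trans (le_of_eq ?_)
  ring

/-- **The rate of the antisymmetric gradient on the whole slab**: for every `k` there is `D ≥ 0` with
`‖DᵏA_ij[G(t)](y)‖ ≤ D(−t)/(‖y‖+√(−t))^{6+k}` for all `t < 0`, `y`, `i`, `j` (`‖DᵏA_ij[G]‖ ≤ 2‖Dᵏ⁺¹G‖`). By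
`hasDerivAt_iteratedFDeriv_antisymGrad_twinDiff` this is a bound for `∂ₜDᵏA_ij(t,y)`. [folklore] -/
theorem exists_antisymGrad_rate_bound (hcl₁ : IsClassicalNSSolutionOn (Iio (0 : ℝ)) 1 0 V₁ Q₁)
    (hcl₂ : IsClassicalNSSolutionOn (Iio (0 : ℝ)) 1 0 V₂ Q₂) (hB₁ : ScaleInvariantBounds V₁ Q₁)
    (hB₂ : ScaleInvariantBounds V₂ Q₂) (hF : FarDecay 3 V₁ V₂) (k : ℕ) :
    ∃ D : ℝ, 0 ≤ D ∧ ∀ t < 0, ∀ (y : EuclideanSpace ℝ (Fin 3)) (i j : Fin 3),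
      ‖iteratedFDeriv ℝ k (fun y =>
        (fderiv ℝ (fun y => Δ (fun z => V₁ t z - V₂ t z) y -
            (convect (fun z => V₁ t z - V₂ t z) (V₁ t) y + convect (V₂ t) (fun z => V₁ t z - V₂ t z) y))
          y (EuclideanSpace.single i (1 : ℝ))) j -
        (fderiv ℝ (fun y => Δ (fun z => V₁ t z - V₂ t z) y -
            (convect (fun z => V₁ t z - V₂ t z) (V₁ t) y + convect (V₂ t) (fun z => V₁ t z - V₂ t z) y))
          y (EuclideanSpace.single j (1 : ℝ))) i) y‖ ≤ D * (-t) / (‖y‖ + Real.sqrt (-t)) ^ (6 + k) := by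
  obtain ⟨C, hC0, hC⟩ := exists_defectSource_bound hcl₁ hcl₂ hB₁ hB₂ hF (k + 1)
  refine ⟨2 * C, by positivity, fun t ht y i j => ?_⟩
  have h1 := norm_iteratedFDeriv_antisymGrad_le (contDiff_defectSource_slice hcl₁ hcl₂ ht) i j k y
  have h2 := hC t ht y
  rw [show 5 + (k + 1) = 6 + k by ring] at h2
  calc _ ≤ _ := h1
    _ ≤ 2 * (C * (-t) / (‖y‖ + Real.sqrt (-t)) ^ (6 + k)) := mul_le_mul_of_nonneg_left h2 zero_le_two
    _ = 2 * C * (-t) / (‖y‖ + Real.sqrt (-t)) ^ (6 + k) := by ring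

end Twins

/-! ### Registered sub-goal -/

/-- **Registered helper stub `stub_vorticityDefectDynamicsTools`** of `stub_vorticityDefectDecay` (crux
stmt-NavierStokesRegularity-11717, line `moment-conditioned-rellich`): the dynamical tools of this file —
`∂ₜDᵏA_ij = DᵏA_ij[G]`, the rate bound `‖DᵏA_ij[G(t)]‖ ≤ D(−t)/(‖y‖+√(−t))^{6+k}`, and the bound
`‖DⁿG(t)‖ ≤ C(−t)/(‖y‖+√(−t))^{5+n}` for the defect source `G = Δw − ((w·∇)V₁ + (V₂·∇)w)`. [folklore] -/
theorem stub_vorticityDefectDynamicsTools :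
    ∀ (V₁ V₂ : ℝ → EuclideanSpace ℝ (Fin 3) → EuclideanSpace ℝ (Fin 3))
      (Q₁ Q₂ : ℝ → EuclideanSpace ℝ (Fin 3) → ℝ),
      IsClassicalNSSolutionOn (Iio (0 : ℝ)) 1 0 V₁ Q₁ → IsClassicalNSSolutionOn (Iio (0 : ℝ)) 1 0 V₂ Q₂ →
      (∀ (k : ℕ) (t : ℝ), t < 0 → ∀ (x : EuclideanSpace ℝ (Fin 3)) (i j : Fin 3),
        HasDerivAt (fun s => iteratedFDeriv ℝ k (fun y : EuclideanSpace ℝ (Fin 3) =>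
            (fderiv ℝ (fun z => V₁ s z - V₂ s z) y (EuclideanSpace.single i (1 : ℝ))) j -
            (fderiv ℝ (fun z => V₁ s z - V₂ s z) y (EuclideanSpace.single j (1 : ℝ))) i) x)
          (iteratedFDeriv ℝ k (fun y : EuclideanSpace ℝ (Fin 3) =>
            (fderiv ℝ
                (fun y => Laplacian.laplacian (fun z => V₁ t z - V₂ t z) y -
                  (convect (fun z => V₁ t z - V₂ t z) (V₁ t) y + convect (V₂ t) (fun z => V₁ t z - V₂ t z) y)) y (EuclideanSpace.single i (1 : ℝ))) j -
            (fderiv ℝ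
                (fun y => Laplacian.laplacian (fun z => V₁ t z - V₂ t z) y -
                  (convect (fun z => V₁ t z - V₂ t z) (V₁ t) y + convect (V₂ t) (fun z => V₁ t z - V₂ t z) y)) y (EuclideanSpace.single j (1 : ℝ))) i) x) t) ∧
      (ScaleInvariantBounds V₁ Q₁ → ScaleInvariantBounds V₂ Q₂ → FarDecay 3 V₁ V₂ →
        (∀ k : ℕ, ∃ D : ℝ, 0 ≤ D ∧ ∀ t < 0, ∀ (y : EuclideanSpace ℝ (Fin 3)) (i j : Fin 3),
          ‖iteratedFDeriv ℝ k (fun y : EuclideanSpace ℝ (Fin 3) =>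
            (fderiv ℝ
                (fun y => Laplacian.laplacian (fun z => V₁ t z - V₂ t z) y -
                  (convect (fun z => V₁ t z - V₂ t z) (V₁ t) y + convect (V₂ t) (fun z => V₁ t z - V₂ t z) y)) y (EuclideanSpace.single i (1 : ℝ))) j -
            (fderiv ℝ
                (fun y => Laplacian.laplacian (fun z => V₁ t z - V₂ t z) y -
                  (convect (fun z => V₁ t z - V₂ t z) (V₁ t) y + convect (V₂ t) (fun z => V₁ t z - V₂ t z) y)) y (EuclideanSpace.single j (1 : ℝ))) i) y‖ ≤
            D * (-t) / (‖y‖ + Real.sqrt (-t)) ^ (6 + k)) ∧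
        (∀ n : ℕ, ∃ C : ℝ, 0 ≤ C ∧ ∀ t < 0, ∀ y : EuclideanSpace ℝ (Fin 3),
          ‖iteratedFDeriv ℝ n
              (fun y => Laplacian.laplacian (fun z => V₁ t z - V₂ t z) y -
                (convect (fun z => V₁ t z - V₂ t z) (V₁ t) y + convect (V₂ t) (fun z => V₁ t z - V₂ t z) y)) y‖ ≤
            C * (-t) / (‖y‖ + Real.sqrt (-t)) ^ (5 + n))) :=
  fun _V₁ _V₂ _Q₁ _Q₂ hcl₁ hcl₂ =>
    ⟨fun k _t ht x i j => hasDerivAt_iteratedFDeriv_antisymGrad_twinDiff hcl₁ hcl₂ k ht x i j,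
      fun hB₁ hB₂ hF => ⟨fun k => exists_antisymGrad_rate_bound hcl₁ hcl₂ hB₁ hB₂ hF k,
        fun n => exists_defectSource_bound hcl₁ hcl₂ hB₁ hB₂ hF n⟩⟩

end Summit.NavierStokesRegularity.NavierStokesRegularity.Theorems.RellichScarScarRigidity

end
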